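/-
Copyright (c) 2026. All rights reserved.
Released under Apache 2.0 license as described in the file LICENSE.
-/
import Literature.NumberTheory.ComplexMultiplication.SporadicSubsetsOddAnnihilators
import Literature.AlgebraicGeometry.Pohlmann1968.PowerDivisorSetsOfPrimitiveType
import Literature.AlgebraicGeometry.Pohlmann1968.MumfordSimpleFourfoldOfPrimitive
import Literature.AlgebraicGeometry.ComplexMultiplication.SimpleIffPrimitiveCMType
import HarnessLib

/-!
# White 1993, PROPOSITION 1 and LEMMA 2 for an ARBITRARY CM field: exceptional Hodge classes on `A` (resp. on some
# power `Aⁿ`) of a simple CM abelian variety ⟷ odd `{0, ±1}`-valued (resp. integer) annihilators of the Galois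
# translates of the CM type; nondegenerate ⟷ no odd annihilator

Abelian-variety dress of `NumberTheory/ComplexMultiplication/SporadicSubsetsOddAnnihilators` (the same dictionary for an
arbitrary action) on the tree's carriers: `Hom(K, ℂ)` with its `Aut(ℂ)`-action (`EmbeddingAction`), Pohlmann's index sets
`pohlmannSets` / `pohlmannDivisorSets` (`Pohlmann1968/HodgeClassesCMType`, `DivisorClassesCMType`), the weights of the
powers `pohlmannSetsAlg` / `pohlmannDivisorSetsAlg` with their multiplicities `embMult` (`…/HodgeClassesCMAlgebra`,
`NondegenerateCMTypeDivisorClasses`, `PowerDivisorSetsOfPrimitiveType`), and realisations `IsCMTypeRealisation Φ A ι θ`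
read on `H¹` with their powers `Aⁿ = ⨁_{i<n} A`.  THEOREMS ONLY (no definition, no named fact, no `sorry`).

## The print

S. P. White, *Sporadic cycles on CM abelian varieties*, Compositio Math. **88** (1993) 123–142
[White1993SporadicCycles], §4 (p. 130): «We have converted the question of the existence of sporadic cycles into a
question about the existence of certain zero divisors in a group ring. Any element of `ℚ[G]⁻` whose coefficients are
all `±1` can be put in the form `S − cS`. Similarly, any element whose coefficients are `0, ±1` can put in the form
`Δ⁻¹ − cΔ⁻¹`. If the product of the two is zero then the elements correspond to a CM-type for which there exists a
sporadic cycle. If no such `Δ⁻¹ − cΔ⁻¹` exists for a specific choice of `S − cS` then the ring of Hodge cycles of any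
associated abelian variety `A` is generated by the classes of divisors.  However, if we consider higher powers `Aⁿ` of
`A`, a sporadic cycle on `Aⁿ` would correspond to a right annihilator of `S − cS` in `ℚ[G]⁻` whose coefficients are
`0, ±1, …, ±n`. Thus if `S − cS` is not a `G`-module generator of `ℚ[G]⁻` or equivalently has a right annihilator then
there exists a high enough power `Aⁿ` such that `Aⁿ` has a sporadic cycle.»  **LEMMA 2**: «The rank of the
corresponding Mumford–Tate group is maximal if and only if `S − cS` is a `G`-module generator of `ℚ[G]⁻`.»
**PROPOSITION 1** (p. 132; `K` Galois with group `ℤ/2 × G₀`, `S` simple): «the following three conditions are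
equivalent. 1. The divisor classes do not generate the Hodge ring of any abelian variety of CM-type `(K, S)`. 2. There
exists a sporadic `Δ`. 3. There exists (nonzero) `β ∈ ℚ[G₀]` whose coefficients are `±1` or `0` such that `α·β = 0`.»

Here `K` is ANY CM field (Galois or not): White's `G` is replaced by `Aut(ℂ)` acting on `Hom(K, ℂ)` (through
`Gal(Kᶜ/ℚ)`; for `K` Galois, `Hom(K, ℂ) ≅ G`), an element of `ℚ[G]⁻` by an ODD weight `β : Hom(K, ℂ) → ℚ`
(`β(s̄) = −β(s)`), «right annihilator of `S − cS`» by `Σ_s β(s)[τs ∈ Φ] = 0` for every `τ ∈ Aut(ℂ)`, and «simple CM-type»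
by PRIMITIVE (the `Aut(ℂ)`-translates of `Φ` separate the embeddings; Shimura §8.2 Prop. 26).

## What is proved (`K` a CM field, `Φ : CMType K`)

* §1 `exists_notConjClosed_pohlmannSets_iff_exists_sporadicSet` (White's sporadic `Δ` = a Pohlmann set not closed under
  conjugation) and **`exists_notConjClosed_pohlmannSets_iff_exists_oddAnnihilator`** (PROP. 1 (2) ⟺ (3), any CM field).
* §2 **PROP. 1 (1) ⟺ (2) ⟺ (3) for `Φ` PRIMITIVE and every realisation `A`** (so «any» = «every»):
  `exists_exceptional_iff_exists_sporadicSet`, **`exists_exceptional_iff_exists_oddAnnihilator`** (+`_of_isPrimitive`,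
  `_of_isSimple`) — `A` carries a rational `(m,m)`-class outside `Dᵐ(A) ⊗ ℂ` for some `m` iff a nonzero odd
  `{0, ±1}`-valued annihilator exists;
  `forall_hodgeClassSpan_eq_iff_forall_oddAnnihilator_signs_eq_zero` («if no such `Δ⁻¹ − cΔ⁻¹` exists … the ring of Hodge
  cycles of any associated abelian variety `A` is generated by the classes of divisors»).
* §3 **the powers** (`Φ` primitive): `exists_weight_embMult_eq` (every multiplicity function `≤ n` is a
  weight of `Aⁿ`), **`exists_pohlmannSetsAlg_diff_nonempty_iff_exists_intOddAnnihilator_le`** (an exceptional weight of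
  `Φ^{×n}` ⟺ a nonzero odd INTEGER annihilator with `|β| ≤ n` — «coefficients `0, ±1, …, ±n`»),
  **`exists_exceptional_pow_iff_exists_intOddAnnihilator_le`** / `exists_exceptional_pow_iff_exists_intOddAnnihilator`
  (+`_of_isSimple`) (on the realisations `Aⁿ`).
* §4 **LEMMA 2 for every CM field**: **`isNondegenerate_iff_forall_oddAnnihilator_eq_zero`**,
  `not_isNondegenerate_iff_exists_intOddAnnihilator`; with §3, Hazama's converse re-derived through annihilators
  (`not_isNondegenerate_iff_exists_exceptional_pow`, cf. the tree's `isNondegenerate_iff_forall_pow_hodgeClassSpan_eq`).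

Why this matters for the tree: condition (3) is a finite CERTIFICATE FORMAT — an odd `{0, ±1}`- (or bounded integer-)
vector annihilating the finitely many translates of `Φ` — for the existence of exceptional classes on `A` (resp. `Aⁿ`) of
ANY simple CM abelian variety, and its absence certifies that the Hodge ring of `A` is generated by divisors (the form in
which White's Theorem 1/4 counterexample, `G₀ = ℤ/2 × ℤ/5 × D₅`, would be checked).  Nothing here bears on algebraicity.

## References
* [White1993SporadicCycles] S. P. White, Compositio Math. 88 (1993) — §4 p. 130, Lemma 2, §5 Prop. 1.
* [Gordon1999HodgeAVSurvey] B. B. Gordon (1999) — §9.2 (9.2.1), 9.2.2 ([B.138]), §9.3, Thm. 6.4.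
* [Pohlmann1968] H. Pohlmann (1968) — Thm. 1, §3.  [Milne2020HodgeClassesAV] J. S. Milne (2020) — 1.2 (c).
* [Shimura1998] G. Shimura (1998) — §8.2 Prop. 26, §18.2 Lemma (i).  [Kubota1965] T. Kubota (1965) — §2.

## Provenance
Cell `pub-hodgecm2` (COR-CM), literature seat `lit-deligne-3` gen 20 (claim PROP1-GENERAL; count-neutral).
-/

set_option autoImplicit false

noncomputable section

open scoped BigOperators NumberField Classical
open CategoryTheory CategoryTheory.Limits NumberField Module

namespace Literature.AlgebraicGeometry.Pohlmann1968

open Literature.NumberTheory.ComplexMultiplication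
open Literature.AlgebraicGeometry.Motives (AbelianVariety CMType)
open Literature.AlgebraicGeometry.HodgeTheory
open Literature.AlgebraicGeometry.VanGeemen1994 (hodgeClassSpan)
open Literature.AlgebraicGeometry.ComplexMultiplication (IsCMTypeRealisation isPrimitive_ringEquiv_complex_iff
  isSimple_iff_primitive)
open Literature.Barriers.HodgeConjecture (divisorClassesSpan)

variable {K : Type} [Field K] [NumberField K] [IsCMField K]

/-! ## §1 Sporadic Pohlmann sets and odd `{0, ±1}`-annihilators on `Hom(K, ℂ)` -/

omit [IsCMField K] in
/-- **White's sporadic `Δ` on the embeddings**: some Pohlmann set (`|Δ| = 2m`, Galois-balanced) is NOT closed under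
complex conjugation iff some finite `Δ ⊆ Hom(K, ℂ)` has balanced indicator (`IsBalanced` for the `Aut(ℂ)`-action) and
a member whose conjugate is outside (`|Δ|` is then automatically even). [cite: White1993SporadicCycles, §1 (p. 124) and §4]
[cite: Gordon1999HodgeAVSurvey, 9.2.2] -/
theorem exists_notConjClosed_pohlmannSets_iff_exists_sporadicSet (Φ : CMType K) :
    (∃ m : ℕ, ∃ Δ ∈ pohlmannSets Φ m, ∃ φ ∈ Δ, ComplexEmbedding.conjugate φ ∉ Δ) ↔
      ∃ Δ : Finset (K →+* ℂ), IsBalanced (ℂ ≃+* ℂ) Φ.1 (fun s => if s ∈ Δ then (1 : ℚ) else 0) ∧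
        ∃ φ ∈ Δ, ComplexEmbedding.conjugate φ ∉ Δ := by
  constructor
  · rintro ⟨m, Δ, hΔ, φ, hφ, hφ'⟩
    exact ⟨Δ, (isGaloisBalanced_iff_isBalanced Φ Δ).1 hΔ.2, φ, hφ, hφ'⟩
  · rintro ⟨Δ, hbal, φ, hφ, hφ'⟩
    have hG : IsGaloisBalanced Φ Δ := (isGaloisBalanced_iff_isBalanced Φ Δ).2 hbal
    have hcard := (isGaloisBalanced_iff_two_mul Φ Δ).1 hG 1
    exact ⟨_, Δ, ⟨hcard.symm, hG⟩, φ, hφ, hφ'⟩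

/-- **PROPOSITION 1, (2) ⟺ (3), for an arbitrary CM field**: a sporadic Pohlmann set exists iff there is a nonzero ODD
`{0, ±1}`-valued weight `β` on `Hom(K, ℂ)` (`β(s̄) = −β(s)`) annihilating every `Aut(ℂ)`-translate of `Φ`
(`Σ_s β(s)[τs ∈ Φ] = 0`) — «(nonzero) `β ∈ ℚ[G₀]` whose coefficients are `±1` or `0` such that `α·β = 0`».
[cite: White1993SporadicCycles, §5 Prop. 1 and §4 (p. 130)] -/
theorem exists_notConjClosed_pohlmannSets_iff_exists_oddAnnihilator (Φ : CMType K) :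
    (∃ m : ℕ, ∃ Δ ∈ pohlmannSets Φ m, ∃ φ ∈ Δ, ComplexEmbedding.conjugate φ ∉ Δ) ↔
      ∃ β : (K →+* ℂ) → ℚ, (∀ s, β s = 0 ∨ β s = 1 ∨ β s = -1) ∧ β ≠ 0 ∧
        (∀ s, β (ComplexEmbedding.conjugate s) = -β s) ∧
        ∀ τ : ℂ ≃+* ℂ, ∑ s, β s * translateInd Φ.1 τ s = 0 := by
  rw [exists_notConjClosed_pohlmannSets_iff_exists_sporadicSet]
  have h := (isCMTypeWith_conj Φ).exists_sporadicSet_iff_exists_oddAnnihilator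
  simp only [conj_smul_eq_conjugate] at h
  exact h

/-! ## §2 PROPOSITION 1 for a PRIMITIVE type and its abelian varieties -/

section Realisations

variable {Φ : CMType K} {A : AbelianVariety ℂ} {ι : 𝓞 K →+* End A} {θ : K →+* Module.End ℂ (complexBetti A.X 1)}

/-- **PROP. 1, (1) ⟺ (2)**: for `Φ` PRIMITIVE and ANY realisation `(A, ι, θ)` of `(K; Φ)`, `A` carries a rational
`(m,m)`-class outside `Dᵐ(A) ⊗ ℂ` for some `m` iff a sporadic `Δ ⊆ Hom(K, ℂ)` exists (Pohlmann's criterion, tree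
`exists_exceptional_iff_of_primitive`; in particular «any abelian variety of CM-type `(K, S)`» = every one).
[cite: White1993SporadicCycles, §5 Prop. 1 ((1) ⟺ (2)) and §1 (p. 124)] [cite: Pohlmann1968, Thm. 1 and §3] -/
theorem exists_exceptional_iff_exists_sporadicSet
    (hsep : ∀ s t : K →+* ℂ,
      (∀ τ : ℂ ≃+* ℂ, ((τ : ℂ →+* ℂ).comp s ∈ Φ.1 ↔ (τ : ℂ →+* ℂ).comp t ∈ Φ.1)) → s = t)
    (hA : IsCMTypeRealisation Φ A ι θ) :
    (∃ m : ℕ, ∃ c : complexBetti A.X (2 * m), IsRationalClass c ∧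
        IsOfHodgeType (finrank ℚ K / 2) A.X (2 * m) m m c ∧ c ∉ divisorClassesSpan A.X (finrank ℚ K / 2) m) ↔
      ∃ Δ : Finset (K →+* ℂ), IsBalanced (ℂ ≃+* ℂ) Φ.1 (fun s => if s ∈ Δ then (1 : ℚ) else 0) ∧
        ∃ φ ∈ Δ, ComplexEmbedding.conjugate φ ∉ Δ := by
  rw [← exists_notConjClosed_pohlmannSets_iff_exists_sporadicSet]
  exact exists_congr fun m => exists_exceptional_iff_of_primitive hA hsep m

/-- **PROPOSITION 1, (1) ⟺ (3), for an arbitrary CM field**: for `Φ` primitive («simple CM-type») and any abelian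
variety `A` of type `(K; Φ)`, the divisor classes fail to generate the Hodge ring of `A` — a rational `(m,m)`-class on
`A` outside `Dᵐ(A) ⊗ ℂ` exists — iff there is a nonzero odd `{0, ±1}`-valued `β` on `Hom(K, ℂ)` annihilating all
`Aut(ℂ)`-translates of `Φ`. [cite: White1993SporadicCycles, §5 Prop. 1 and §4 (p. 130)] [cite: Pohlmann1968, Thm. 1 and §3] -/
theorem exists_exceptional_iff_exists_oddAnnihilator
    (hsep : ∀ s t : K →+* ℂ,
      (∀ τ : ℂ ≃+* ℂ, ((τ : ℂ →+* ℂ).comp s ∈ Φ.1 ↔ (τ : ℂ →+* ℂ).comp t ∈ Φ.1)) → s = t)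
    (hA : IsCMTypeRealisation Φ A ι θ) :
    (∃ m : ℕ, ∃ c : complexBetti A.X (2 * m), IsRationalClass c ∧
        IsOfHodgeType (finrank ℚ K / 2) A.X (2 * m) m m c ∧ c ∉ divisorClassesSpan A.X (finrank ℚ K / 2) m) ↔
      ∃ β : (K →+* ℂ) → ℚ, (∀ s, β s = 0 ∨ β s = 1 ∨ β s = -1) ∧ β ≠ 0 ∧
        (∀ s, β (ComplexEmbedding.conjugate s) = -β s) ∧
        ∀ τ : ℂ ≃+* ℂ, ∑ s, β s * translateInd Φ.1 τ s = 0 := by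
  rw [← exists_notConjClosed_pohlmannSets_iff_exists_oddAnnihilator]
  exact exists_congr fun m => exists_exceptional_iff_of_primitive hA hsep m

/-- The same with primitivity as `IsPrimitive` (Shimura §8.2 Prop. 26). [cite: White1993SporadicCycles, §5 Prop. 1]
[cite: Shimura1998, §8.2 Prop. 26] -/
theorem exists_exceptional_iff_exists_oddAnnihilator_of_isPrimitive {s₀ : K →+* ℂ}
    (hprim : IsPrimitive (ℂ ≃+* ℂ) Φ.1 s₀) (hA : IsCMTypeRealisation Φ A ι θ) :
    (∃ m : ℕ, ∃ c : complexBetti A.X (2 * m), IsRationalClass c ∧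
        IsOfHodgeType (finrank ℚ K / 2) A.X (2 * m) m m c ∧ c ∉ divisorClassesSpan A.X (finrank ℚ K / 2) m) ↔
      ∃ β : (K →+* ℂ) → ℚ, (∀ s, β s = 0 ∨ β s = 1 ∨ β s = -1) ∧ β ≠ 0 ∧
        (∀ s, β (ComplexEmbedding.conjugate s) = -β s) ∧
        ∀ τ : ℂ ≃+* ℂ, ∑ s, β s * translateInd Φ.1 τ s = 0 :=
  exists_exceptional_iff_exists_oddAnnihilator ((isPrimitive_ringEquiv_complex_iff Φ s₀).1 hprim) hA

/-- **PROP. 1 (1) ⟺ (3) with «simple» as a hypothesis on `A`** (a realisation is simple iff its type is primitive,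
Shimura §8.2 Prop. 26, tree `isSimple_iff_primitive`): a SIMPLE CM abelian variety `A` (any CM field) carries a
rational `(m,m)`-class outside `Dᵐ(A) ⊗ ℂ` for some `m` iff a nonzero odd `{0, ±1}`-valued annihilator of the translates
of its type exists. [cite: White1993SporadicCycles, §5 Prop. 1] [cite: Shimura1998, §8.2 Prop. 26] -/
theorem exists_exceptional_iff_exists_oddAnnihilator_of_isSimple (hA : IsCMTypeRealisation Φ A ι θ)
    (hS : A.IsSimple) :
    (∃ m : ℕ, ∃ c : complexBetti A.X (2 * m), IsRationalClass c ∧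
        IsOfHodgeType (finrank ℚ K / 2) A.X (2 * m) m m c ∧ c ∉ divisorClassesSpan A.X (finrank ℚ K / 2) m) ↔
      ∃ β : (K →+* ℂ) → ℚ, (∀ s, β s = 0 ∨ β s = 1 ∨ β s = -1) ∧ β ≠ 0 ∧
        (∀ s, β (ComplexEmbedding.conjugate s) = -β s) ∧
        ∀ τ : ℂ ≃+* ℂ, ∑ s, β s * translateInd Φ.1 τ s = 0 :=
  exists_exceptional_iff_exists_oddAnnihilator ((isSimple_iff_primitive hA).1 hS) hA

/-- **«If no such `Δ⁻¹ − cΔ⁻¹` exists for a specific choice of `S − cS` then the ring of Hodge cycles of any associated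
abelian variety `A` is generated by the classes of divisors»**: `Bᵐ(A) ⊗ ℂ = Dᵐ(A) ⊗ ℂ` for all `m` iff every odd
`{0, ±1}`-valued annihilator vanishes (`Φ` primitive). [cite: White1993SporadicCycles, §4 (p. 130)] -/
theorem forall_hodgeClassSpan_eq_iff_forall_oddAnnihilator_signs_eq_zero
    (hsep : ∀ s t : K →+* ℂ,
      (∀ τ : ℂ ≃+* ℂ, ((τ : ℂ →+* ℂ).comp s ∈ Φ.1 ↔ (τ : ℂ →+* ℂ).comp t ∈ Φ.1)) → s = t)
    (hA : IsCMTypeRealisation Φ A ι θ) :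
    (∀ m : ℕ, hodgeClassSpan (finrank ℚ K / 2) A.X m = divisorClassesSpan A.X (finrank ℚ K / 2) m) ↔
      ∀ β : (K →+* ℂ) → ℚ, (∀ s, β s = 0 ∨ β s = 1 ∨ β s = -1) →
        (∀ s, β (ComplexEmbedding.conjugate s) = -β s) →
        (∀ τ : ℂ ≃+* ℂ, ∑ s, β s * translateInd Φ.1 τ s = 0) → β = 0 := by
  constructor
  · intro h β hval hodd hann
    by_contra hne
    obtain ⟨m, c, hcQ, hcH, hcD⟩ :=
      (exists_exceptional_iff_exists_oddAnnihilator hsep hA).2 ⟨β, hval, hne, hodd, hann⟩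
    exact hcD ((h m) ▸ Submodule.subset_span ⟨hcQ, hcH⟩)
  · intro H m
    refine le_antisymm (Submodule.span_le.2 fun d hd => ?_) (divisorClassesSpan_le_hodgeClassSpan hA m)
    by_contra hdD
    obtain ⟨β, hval, hne, hodd, hann⟩ :=
      (exists_exceptional_iff_exists_oddAnnihilator hsep hA).1 ⟨m, d, hd.1, hd.2, hdD⟩
    exact hne (H β hval hodd hann)

end Realisations

/-! ## §3 The powers `Aⁿ`: odd integer annihilators with coefficients `≤ n` -/

section Powers

variable {Φ : CMType K} {n : ℕ}

omit [NumberField K] [IsCMField K] in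
/-- A weight of `Aⁿ` has every multiplicity `≤ n` (the members over `s` inject into the `n` slots). [folklore] -/
private theorem embMult_le (U : Finset ((_ : Fin n) × (K →+* ℂ))) (s : K →+* ℂ) : embMult U s ≤ n := by
  unfold embMult
  calc (U.filter fun x => x.2 = s).card ≤ (Finset.univ : Finset (Fin n)).card :=
        Finset.card_le_card_of_injOn (fun x => x.1) (fun _ _ => Finset.mem_coe.2 (Finset.mem_univ _))
          (by
            rintro x hx y hy hxy
            simp only [Finset.coe_filter, Set.mem_setOf_eq] at hx hy
            exact Sigma.ext hxy (heq_of_eq (hx.2.trans hy.2.symm)))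
    _ = n := by rw [Finset.card_univ, Fintype.card_fin]

omit [IsCMField K] in
/-- **Every multiplicity function `f ≤ n` is the multiplicity function of a weight of `Aⁿ`**: `U = {(i, s) | i < f(s)}`
(«any element whose coefficients are `0, ±1, …` can be put in the form `Δ⁻¹ − cΔ⁻¹`» for a multiset `Δ`; the tree's
construction in `exists_mem_pohlmannSetsAlg_diff_of_not_isNondegenerate`). [cite: White1993SporadicCycles, §4 (p. 130)] -/
theorem exists_weight_embMult_eq (f : (K →+* ℂ) → ℕ) (hf : ∀ s, f s ≤ n) :
    ∃ U : Finset ((_ : Fin n) × (K →+* ℂ)), ∀ s, embMult U s = f s := by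
  refine ⟨Finset.univ.filter fun x => (x.1 : ℕ) < f x.2, fun s => ?_⟩
  unfold embMult
  rw [Finset.filter_filter]
  have himage : ((Finset.univ.filter fun x : (_ : Fin n) × (K →+* ℂ) => (x.1 : ℕ) < f x.2 ∧ x.2 = s).image
      fun x => (x.1 : ℕ)) = Finset.range (f s) := by
    ext j
    simp only [Finset.mem_image, Finset.mem_filter, Finset.mem_univ, true_and, Finset.mem_range]
    constructor
    · rintro ⟨x, ⟨hx, rfl⟩, rfl⟩; exact hx
    · intro hj; exact ⟨⟨⟨j, lt_of_lt_of_le hj (hf s)⟩, s⟩, ⟨hj, rfl⟩, rfl⟩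
  rw [← Finset.card_range (f s), ← himage, Finset.card_image_of_injOn]
  rintro x hx y hy hxy
  simp only [Finset.coe_filter, Set.mem_setOf_eq] at hx hy
  exact Sigma.ext (Fin.ext hxy) (heq_of_eq (hx.2.2.trans hy.2.2.symm))

/-- **An exceptional weight of `Φ^{×n}` ⟺ a nonzero odd INTEGER annihilator with `|β| ≤ n`** (`Φ` PRIMITIVE): «a
sporadic cycle on `Aⁿ` would correspond to a right annihilator of `S − cS` in `ℚ[G]⁻` whose coefficients are
`0, ±1, …, ±n`».  ⟹: the exceptional weights are the balanced weights with a conjugation-asymmetric multiplicity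
(tree `pohlmannSetsAlg_diff_eq_of_separating`), and `β = mult_U − mult_U ∘ conj`; ⟸: `U` with `mult_U = β⁺`.
[cite: White1993SporadicCycles, §4 (p. 130)] [cite: Gordon1999HodgeAVSurvey, 9.2.2] -/
theorem exists_pohlmannSetsAlg_diff_nonempty_iff_exists_intOddAnnihilator_le
    (hsep : ∀ s t : K →+* ℂ,
      (∀ τ : ℂ ≃+* ℂ, ((τ : ℂ →+* ℂ).comp s ∈ Φ.1 ↔ (τ : ℂ →+* ℂ).comp t ∈ Φ.1)) → s = t) (n : ℕ) :
    (∃ m : ℕ, (pohlmannSetsAlg (K := fun _ : Fin n => K) (fun _ => Φ) m \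
        pohlmannDivisorSetsAlg (K := fun _ : Fin n => K) (fun _ => Φ) m).Nonempty) ↔
      ∃ β : (K →+* ℂ) → ℤ, β ≠ 0 ∧ (∀ s, β (ComplexEmbedding.conjugate s) = -β s) ∧
        (∀ τ : ℂ ≃+* ℂ, ∑ s, (β s : ℚ) * translateInd Φ.1 τ s = 0) ∧ ∀ s, (β s).natAbs ≤ n := by
  have h := isCMTypeWith_conj Φ
  constructor
  · rintro ⟨m, hne⟩
    rw [pohlmannSetsAlg_diff_eq_of_separating Φ hsep m] at hne
    obtain ⟨U, hU, s, hs⟩ := hne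
    have hbal : IsBalanced (ℂ ≃+* ℂ) Φ.1 (fun t => (embMult U t : ℚ)) :=
      (isGaloisBalancedAlg_const_iff Φ U).1 (mem_pohlmannSetsAlg_iff.1 hU).2
    have hs' : embMult U ((starRingAut : ℂ ≃+* ℂ) • s) ≠ embMult U s := by rwa [conj_smul_eq_conjugate]
    obtain ⟨β, hne, hodd, hann, hbd⟩ := h.exists_intOddAnnihilator_of_isBalanced_nat hbal hs'
    refine ⟨β, hne, fun t => ?_, hann, fun t => (hbd t).trans ?_⟩
    · rw [← conj_smul_eq_conjugate]; exact hodd t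
    · exact max_le (embMult_le U t) (embMult_le U _)
  · rintro ⟨β, hne, hodd, hann, hbd⟩
    have hodd' : ∀ t, β ((starRingAut : ℂ ≃+* ℂ) • t) = -β t := fun t => by
      rw [conj_smul_eq_conjugate]; exact hodd t
    -- the weight `U` of `Aⁿ` with `mult_U = β⁺`
    obtain ⟨U, hU⟩ := exists_weight_embMult_eq (n := n) (fun t => (β t).toNat) fun t => by
      have := hbd t; omega
    have hf : IsBalanced (ℂ ≃+* ℂ) Φ.1 (fun t => ((β t).toNat : ℚ)) :=
      h.isBalanced_posPart_of_intOddAnnihilator hodd' hann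
    have hfun : (fun t => (embMult U t : ℚ)) = fun t => ((β t).toNat : ℚ) := funext fun t => by rw [hU]
    have hG : IsGaloisBalancedAlg (fun _ : Fin n => Φ) U := by
      rw [isGaloisBalancedAlg_const_iff Φ U, hfun]; exact hf
    have hcard := hG.card_eq_two_mul
    refine ⟨_, U, mem_pohlmannSetsAlg_iff.2 ⟨hcard, hG⟩, fun hD => ?_⟩
    obtain ⟨y, hy⟩ := IsCMTypeWith.exists_posPart_rho_ne_of_ne_zero (E := K →+* ℂ) hodd' hne
    have hsym := ((mem_pohlmannDivisorSetsAlg_const_iff_of_separating Φ hsep _ U).1 hD).2 y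
    rw [hU, hU] at hsym
    rw [conj_smul_eq_conjugate] at hy
    exact hy hsym

variable {A : AbelianVariety ℂ} {ι : 𝓞 K →+* End A} {θ : K →+* Module.End ℂ (complexBetti A.X 1)}

/-- **On the abelian varieties: an exceptional Hodge class on the power `Aⁿ` ⟺ a nonzero odd integer annihilator with
coefficients `≤ n`** (`Φ` primitive, `(A, ι, θ)` any realisation, `Aⁿ = ⨁_{i<n} A`; Pohlmann's criterion for the CM
algebra `Kⁿ`, tree `exists_exceptional_biproduct_iff`). [cite: White1993SporadicCycles, §4 (p. 130)]
[cite: Gordon1999HodgeAVSurvey, 9.2.2 and Thm. 6.4] -/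
theorem exists_exceptional_pow_iff_exists_intOddAnnihilator_le
    (hsep : ∀ s t : K →+* ℂ,
      (∀ τ : ℂ ≃+* ℂ, ((τ : ℂ →+* ℂ).comp s ∈ Φ.1 ↔ (τ : ℂ →+* ℂ).comp t ∈ Φ.1)) → s = t)
    (hA : IsCMTypeRealisation Φ A ι θ) (n : ℕ) :
    (∃ m : ℕ, ∃ c : complexBetti (⨁ fun _ : Fin n => A).X (2 * m), IsRationalClass c ∧
        IsOfHodgeType (⨁ fun _ : Fin n => A).dim (⨁ fun _ : Fin n => A).X (2 * m) m m c ∧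
        c ∉ divisorClassesSpan (⨁ fun _ : Fin n => A).X (⨁ fun _ : Fin n => A).dim m) ↔
      ∃ β : (K →+* ℂ) → ℤ, β ≠ 0 ∧ (∀ s, β (ComplexEmbedding.conjugate s) = -β s) ∧
        (∀ τ : ℂ ≃+* ℂ, ∑ s, (β s : ℚ) * translateInd Φ.1 τ s = 0) ∧ ∀ s, (β s).natAbs ≤ n := by
  rw [← exists_pohlmannSetsAlg_diff_nonempty_iff_exists_intOddAnnihilator_le hsep n]
  exact exists_congr fun m => exists_exceptional_biproduct_iff (K := fun _ : Fin n => K) (A := fun _ => A)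
    (Φ := fun _ => Φ) (ι := fun _ => ι) (θ := fun _ => θ) (fun _ => hA) m

/-- **An exceptional Hodge class on SOME power of `A` ⟺ a nonzero odd integer annihilator** («Thus if `S − cS` … has a
right annihilator then there exists a high enough power `Aⁿ` such that `Aⁿ` has a sporadic cycle» — `n = max |β|`
suffices; and conversely). [cite: White1993SporadicCycles, §4 (p. 130)] [cite: Gordon1999HodgeAVSurvey, Thm. 6.4] -/
theorem exists_exceptional_pow_iff_exists_intOddAnnihilator
    (hsep : ∀ s t : K →+* ℂ,
      (∀ τ : ℂ ≃+* ℂ, ((τ : ℂ →+* ℂ).comp s ∈ Φ.1 ↔ (τ : ℂ →+* ℂ).comp t ∈ Φ.1)) → s = t)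
    (hA : IsCMTypeRealisation Φ A ι θ) :
    (∃ n m : ℕ, ∃ c : complexBetti (⨁ fun _ : Fin n => A).X (2 * m), IsRationalClass c ∧
        IsOfHodgeType (⨁ fun _ : Fin n => A).dim (⨁ fun _ : Fin n => A).X (2 * m) m m c ∧
        c ∉ divisorClassesSpan (⨁ fun _ : Fin n => A).X (⨁ fun _ : Fin n => A).dim m) ↔
      ∃ β : (K →+* ℂ) → ℤ, β ≠ 0 ∧ (∀ s, β (ComplexEmbedding.conjugate s) = -β s) ∧
        ∀ τ : ℂ ≃+* ℂ, ∑ s, (β s : ℚ) * translateInd Φ.1 τ s = 0 := by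
  constructor
  · rintro ⟨n, hn⟩
    obtain ⟨β, hne, hodd, hann, -⟩ := (exists_exceptional_pow_iff_exists_intOddAnnihilator_le hsep hA n).1 hn
    exact ⟨β, hne, hodd, hann⟩
  · rintro ⟨β, hne, hodd, hann⟩
    exact ⟨Finset.univ.sup fun s => (β s).natAbs,
      (exists_exceptional_pow_iff_exists_intOddAnnihilator_le hsep hA _).2
        ⟨β, hne, hodd, hann, fun s => Finset.le_sup (f := fun s => (β s).natAbs) (Finset.mem_univ s)⟩⟩

/-- The same for a SIMPLE `A` (hypothesis on `A` rather than on the type). [cite: White1993SporadicCycles, §4 (p. 130)]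
[cite: Shimura1998, §8.2 Prop. 26] -/
theorem exists_exceptional_pow_iff_exists_intOddAnnihilator_of_isSimple (hA : IsCMTypeRealisation Φ A ι θ)
    (hS : A.IsSimple) :
    (∃ n m : ℕ, ∃ c : complexBetti (⨁ fun _ : Fin n => A).X (2 * m), IsRationalClass c ∧
        IsOfHodgeType (⨁ fun _ : Fin n => A).dim (⨁ fun _ : Fin n => A).X (2 * m) m m c ∧
        c ∉ divisorClassesSpan (⨁ fun _ : Fin n => A).X (⨁ fun _ : Fin n => A).dim m) ↔
      ∃ β : (K →+* ℂ) → ℤ, β ≠ 0 ∧ (∀ s, β (ComplexEmbedding.conjugate s) = -β s) ∧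
        ∀ τ : ℂ ≃+* ℂ, ∑ s, (β s : ℚ) * translateInd Φ.1 τ s = 0 :=
  exists_exceptional_pow_iff_exists_intOddAnnihilator ((isSimple_iff_primitive hA).1 hS) hA

end Powers

/-! ## §4 LEMMA 2 for every CM field: nondegenerate ⟺ no odd annihilator -/

section Lemma2

/-- **LEMMA 2** («The rank of the corresponding Mumford–Tate group is maximal if and only if `S − cS` is a `G`-module
generator of `ℚ[G]⁻`», i.e. has no nonzero right annihilator in `ℚ[G]⁻`) **for an arbitrary CM field**: `Φ` is
nondegenerate (`Rank(Φ) = [K:ℚ]/2 + 1`) iff every odd rational weight on `Hom(K, ℂ)` annihilating all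
`Aut(ℂ)`-translates of `Φ` vanishes. [cite: White1993SporadicCycles, §4 Lemma 2] [cite: Kubota1965, §2] -/
theorem isNondegenerate_iff_forall_oddAnnihilator_eq_zero (Φ : CMType K) :
    IsNondegenerate Φ ↔ ∀ β : (K →+* ℂ) → ℚ, (∀ s, β (ComplexEmbedding.conjugate s) = -β s) →
      (∀ τ : ℂ ≃+* ℂ, ∑ s, β s * translateInd Φ.1 τ s = 0) → β = 0 := by
  have h := (isCMTypeWith_conj Φ).typeRank_eq_iff_forall_oddAnnihilator_eq_zero
  simp only [conj_smul_eq_conjugate] at h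
  rw [isNondegenerate_iff, ← NumberField.Embeddings.card K ℂ]
  exact h

/-- **Degenerate ⟺ a nonzero odd INTEGER annihilator exists** (any CM field). [cite: White1993SporadicCycles, §4 (p. 130) and Lemma 2] -/
theorem not_isNondegenerate_iff_exists_intOddAnnihilator (Φ : CMType K) :
    ¬ IsNondegenerate Φ ↔ ∃ β : (K →+* ℂ) → ℤ, β ≠ 0 ∧ (∀ s, β (ComplexEmbedding.conjugate s) = -β s) ∧
      ∀ τ : ℂ ≃+* ℂ, ∑ s, (β s : ℚ) * translateInd Φ.1 τ s = 0 := by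
  have h := (isCMTypeWith_conj Φ).typeRank_ne_iff_exists_intOddAnnihilator
  simp only [conj_smul_eq_conjugate] at h
  rw [isNondegenerate_iff, ← NumberField.Embeddings.card K ℂ]
  exact h

/-- **A `{0, ±1}`-annihilator forces degeneracy** ((3) ⟹ not (i): «rank(M_A) ≠ dim(A) + 1»).
[cite: White1993SporadicCycles, §4 Lemma 2 and Theorem 3 (proof)] -/
theorem not_isNondegenerate_of_oddAnnihilator (Φ : CMType K) {β : (K →+* ℂ) → ℚ} (hne : β ≠ 0)
    (hodd : ∀ s, β (ComplexEmbedding.conjugate s) = -β s) (hann : ∀ τ : ℂ ≃+* ℂ, ∑ s, β s * translateInd Φ.1 τ s = 0) :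
    ¬ IsNondegenerate Φ := fun hΦ =>
  hne ((isNondegenerate_iff_forall_oddAnnihilator_eq_zero Φ).1 hΦ β hodd hann)

variable {Φ : CMType K} {A : AbelianVariety ℂ} {ι : 𝓞 K →+* End A} {θ : K →+* Module.End ℂ (complexBetti A.X 1)}

/-- **Hazama's converse through annihilators** («if `S − cS` … has a right annihilator then there exists a high enough
power `Aⁿ` such that `Aⁿ` has a sporadic cycle», with LEMMA 2): for `Φ` primitive and any realisation `A`, `Φ` is
degenerate iff some power `Aⁿ` carries a rational `(m,m)`-class outside `Dᵐ(Aⁿ) ⊗ ℂ` (the tree's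
`isNondegenerate_iff_forall_pow_hodgeClassSpan_eq`, re-derived along White's route). [cite: White1993SporadicCycles, §4 (p. 130) and Lemma 2]
[cite: Gordon1999HodgeAVSurvey, Thm. 6.4] -/
theorem not_isNondegenerate_iff_exists_exceptional_pow
    (hsep : ∀ s t : K →+* ℂ,
      (∀ τ : ℂ ≃+* ℂ, ((τ : ℂ →+* ℂ).comp s ∈ Φ.1 ↔ (τ : ℂ →+* ℂ).comp t ∈ Φ.1)) → s = t)
    (hA : IsCMTypeRealisation Φ A ι θ) :
    ¬ IsNondegenerate Φ ↔ ∃ n m : ℕ, ∃ c : complexBetti (⨁ fun _ : Fin n => A).X (2 * m), IsRationalClass c ∧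
      IsOfHodgeType (⨁ fun _ : Fin n => A).dim (⨁ fun _ : Fin n => A).X (2 * m) m m c ∧
      c ∉ divisorClassesSpan (⨁ fun _ : Fin n => A).X (⨁ fun _ : Fin n => A).dim m := by
  rw [not_isNondegenerate_iff_exists_intOddAnnihilator, exists_exceptional_pow_iff_exists_intOddAnnihilator hsep hA]

end Lemma2

end Literature.AlgebraicGeometry.Pohlmann1968

end
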